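import Literature.Topology.FourManifolds.SurfaceGroupRelatorEndIsAutAux
import Literature.Topology.FourManifolds.SurfaceGroupLiftableSymmetries
import Literature.GroupTheory.CombinatorialGroupTheory.QuadraticWordsSurfaceSymbols
import HarnessLib

/-!
# Zieschang–Nielsen: an endomorphism of `F⟨a, b⟩` preserving the surface relator up to
conjugation and inversion is an automorphism (pillar C2 of Nielsen's theorem)

Topic `Literature/Topology/FourManifolds`.  Pillar `(C2)` `RelatorEndIsAut` of the algebraic
proof of Nielsen's lifting theorem (`SurfaceGroupNielsenSetup.lean`): Zieschang–Vogt–Coldewey,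
*Surfaces and Planar Discontinuous Groups*, LNM 835 (1980), Cor. 5.2.13 (*"If `α` is an
endomorphism of `S` with `α(Π_*) = L Π_*^{ε} L⁻¹` then `α` is an automorphism"*; Nielsen 1918
for `g = 1`), from Thm. 5.2.8 in the cyclic form of `SurfaceGroupRelatorEndIsAutAux.lean`.

Proof (`relatorEndIsAut_holds`).  Composing with the orientation-reversing reflection words of
`SurfaceGroupLiftableSymmetries.lean` (an involution of the free group sending `r_g` to a
conjugate of `r_g⁻¹`) reduces to `ε = 1`.  Zieschang's Nielsen reduction
(`exists_related_cyclicallyReduced'`) of the binary product `{Φ(aᵢ), Φ(bᵢ); ∏[aᵢ,bᵢ]}` gives a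
related product — a permutation `w` of the relator word and an automorphism `θ` with `θ(w)`
conjugate to `r_g` — whose values `Φ(θ(xᵢ))` either kill a symbol, or make a symbol
inessential, or are cyclically Nielsen reduced.  In the first two cases deleting the symbol
leaves a balanced word on fewer symbols whose image under `Φ ∘ θ` is still conjugate to `r_g`,
impossible by the rank count `forall_exists_fst_eq_of_map_mk_eq_conj_surfaceWordStd`.  In the
third case every value is a single letter of `r_g` (`toWord_eq_singleton_of_cyclicallyReduced`),
distinct letters of `w` carrying distinct letters of `r_g`; so `Φ ∘ θ` is a signed relabelling of
the generators, an automorphism, and `Φ` is one.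

## References

* H. Zieschang, E. Vogt, H.-D. Coldewey, *Surfaces and Planar Discontinuous Groups*, LNM 835
  (1980), §5.2, Thm. 5.2.8, Cor. 5.2.13. [ZieschangVogtColdewey1980]
* J. Nielsen, *Die Isomorphismen der allgemeinen, unendlichen Gruppe mit zwei Erzeugenden*,
  Math. Ann. 78 (1918) 385–397. [Nielsen1918]
-/

noncomputable section

namespace Literature.Topology.FourManifolds

open Literature.GroupTheory.CombinatorialGroupTheory List

namespace SurfaceGroup

variable {g : ℕ}

/-! ## The reflection of the free group -/

/-- The reflection words `a_k ↦ b_{-k} a_{-k} b_{-k}⁻¹`, `b_k ↦ b_{-k}⁻¹` of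
`SurfaceGroupLiftableSymmetries.lean`. [cite: ZieschangVogtColdewey1980, §3.2] -/
def reflWord (g : ℕ) (p : surfaceGen g) : FreeGroup (surfaceGen g) :=
  cond p.2 (genB (negFin p.1))⁻¹ (genB (negFin p.1) * genA (negFin p.1) * (genB (negFin p.1))⁻¹)

/-- The reflection is an involution of the free group. [folklore] -/
theorem lift_reflWord_lift_reflWord (g : ℕ) (x : FreeGroup (surfaceGen g)) :
    FreeGroup.lift (reflWord g) (FreeGroup.lift (reflWord g) x) = x := by
  have h : (FreeGroup.lift (reflWord g)).comp (FreeGroup.lift (reflWord g)) = MonoidHom.id _ := by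
    refine FreeGroup.ext_hom _ _ fun p => ?_
    rcases p with ⟨k, _ | _⟩
    · simp only [MonoidHom.coe_comp, Function.comp_apply, FreeGroup.lift_apply_of, reflWord,
        cond_false, cond_true, map_mul, map_inv, genA, genB, negFin_negFin, MonoidHom.id_apply]
      group
    · simp only [MonoidHom.coe_comp, Function.comp_apply, FreeGroup.lift_apply_of, reflWord,
        cond_true, map_inv, genB, negFin_negFin, inv_inv, MonoidHom.id_apply]
  exact DFunLike.congr_fun h x

/-- The reflection sends the relator to a conjugate of its inverse. [cite: ZieschangVogtColdewey1980, §3.2] -/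
theorem lift_reflWord_surfaceRelator (g : ℕ) :
    FreeGroup.lift (reflWord g) (surfaceRelator g) =
      (relFactor (FreeGroup.of : surfaceGen g → FreeGroup (surfaceGen g)) 0)⁻¹ * (surfaceRelator g)⁻¹ *
        (relFactor (FreeGroup.of : surfaceGen g → FreeGroup (surfaceGen g)) 0)⁻¹⁻¹ :=
  lift_reflWords_surfaceRelator g

/-! ## Deleting a symbol -/

/-- Deleting a symbol from a balanced word leaves a balanced word. [folklore] -/
theorem isBalanced_filter_fst_ne {ι : Type*} [DecidableEq ι] {w : List (ι × Bool)} (hw : IsBalanced w)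
    (j : ι) : IsBalanced (w.filter fun y => ¬ (y.1 = j)) := by
  intro i
  by_cases hij : i = j
  · subst hij
    rw [count_eq_zero.2, count_eq_zero.2] <;> simp
  · rw [count_filter (by simp [hij]), count_filter (by simp [hij])]
    exact hw i

/-- The tail of a quadratic word beginning with the two letters of a symbol is balanced and
avoids that symbol. [folklore] -/
theorem isBalanced_of_isQuadratic_cons_cons {ι : Type*} [DecidableEq ι] {x : ι × Bool}
    {R : List (ι × Bool)} (h : IsQuadratic (x :: (x.1, !x.2) :: R)) :
    IsBalanced R ∧ ∀ y ∈ R, y.1 ≠ x.1 := by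
  obtain ⟨j, b⟩ := x
  constructor
  · intro i
    have h1 := (h i).1
    simp only [count_cons, beq_iff_eq, Prod.mk.injEq] at h1
    by_cases hji : j = i
    · subst hji
      cases b <;> simp at h1 <;> omega
    · simp [hji] at h1
      exact h1
  · intro y hy hyj
    have h1 := h.count_le_one y
    have h2 := count_pos_iff.2 hy
    obtain ⟨i, c⟩ := y
    simp only at hyj
    subst hyj
    simp only [count_cons, beq_iff_eq, Prod.mk.injEq, true_and] at h1
    cases b <;> cases c <;> simp at h1 <;> omega

/-! ## The pillar -/

/-- **(C2) Zieschang–Nielsen** (ZVC Cor. 5.2.13, closed orientable case; Nielsen 1918 for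
`g = 1`): an endomorphism of `F⟨a, b⟩` sending `r_g = ∏ [aᵢ, bᵢ]` to a conjugate of `r_g^{±1}`
is an automorphism. [cite: ZieschangVogtColdewey1980, Cor. 5.2.13] -/
theorem relatorEndIsAut_holds (g : ℕ) : RelatorEndIsAut g := by
  intro Φ c ε hε hΦ
  -- Step 0: reduce to `ε = 1`
  suffices H : ∀ (Ψ : FreeGroup (surfaceGen g) →* FreeGroup (surfaceGen g)) (d : FreeGroup (surfaceGen g)),
      Ψ (surfaceRelator g) = d * surfaceRelator g * d⁻¹ → Function.Bijective Ψ by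
    rcases hε with rfl | rfl
    · exact H Φ c (by rw [hΦ, zpow_one])
    · set R : FreeGroup (surfaceGen g) →* FreeGroup (surfaceGen g) := FreeGroup.lift (reflWord g) with hR
      have hb : Function.Bijective (Φ.comp R) := by
        refine H (Φ.comp R)
          (Φ (relFactor (FreeGroup.of : surfaceGen g → FreeGroup (surfaceGen g)) 0)⁻¹ * c) ?_
        rw [MonoidHom.comp_apply, hR, lift_reflWord_surfaceRelator]
        simp only [map_mul, map_inv, inv_inv, hΦ, zpow_neg_one, mul_inv_rev]
        group
      have hRR : Function.Bijective R :=
        Function.bijective_iff_has_inverse.2 ⟨R, lift_reflWord_lift_reflWord g, lift_reflWord_lift_reflWord g⟩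
      have e2 : ⇑Φ = ⇑(Φ.comp R) ∘ ⇑R := funext fun x => by
        simp only [Function.comp_apply, MonoidHom.comp_apply, hR, lift_reflWord_lift_reflWord]
      rw [e2]
      exact hb.comp hRR
  intro Ψ d hΨ
  -- genus `0`: the free group is trivial
  rcases Nat.eq_zero_or_pos g with rfl | hg
  · have hsub : ∀ x : FreeGroup (surfaceGen 0), x = 1 := by
      intro x
      induction x using FreeGroup.induction_on with
      | C1 => rfl
      | of p => exact p.1.elim0
      | inv_of p _ => exact p.1.elim0
      | mul x y hx hy => rw [hx, hy, mul_one]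
    exact ⟨fun a b _ => by rw [hsub a, hsub b], fun y => ⟨1, by rw [hsub y, map_one]⟩⟩
  -- Step 1: Zieschang's reduction of the binary product `{Ψ(aᵢ), Ψ(bᵢ); ∏ [aᵢ, bᵢ]}`
  set X₀ : surfaceGen g → FreeGroup (surfaceGen g) := fun i => Ψ (FreeGroup.of i) with hX₀
  have hliftX₀ : FreeGroup.lift X₀ = Ψ := FreeGroup.ext_hom _ _ fun i => by simp [hX₀]
  obtain ⟨w, θ, c', hperm, hθ, htri⟩ :=
    exists_related_cyclicallyReduced' (surfaceWordStd g) (isQuadratic_surfaceWordStd g) X₀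
  set X : surfaceGen g → FreeGroup (surfaceGen g) := fun i => FreeGroup.lift X₀ (θ (FreeGroup.of i)) with hX
  set ψ : FreeGroup (surfaceGen g) →* FreeGroup (surfaceGen g) := Ψ.comp θ.toMonoidHom with hψ
  have hliftX : FreeGroup.lift X = ψ := FreeGroup.ext_hom _ _ fun i => by
    simp [hX, hψ, hliftX₀]
  have hq : IsQuadratic w := (isQuadratic_surfaceWordStd g).perm hperm.symm
  have hlen : w.length = 4 * g := hperm.length_eq.trans (length_surfaceWordStd g)
  -- the value of `w` is conjugate to the relator
  have hval : ψ (FreeGroup.mk w) = (Ψ c' * d) * surfaceRelator g * (Ψ c' * d)⁻¹ := by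
    rw [hψ, MonoidHom.comp_apply, MulEquiv.coe_toMonoidHom, hθ, map_mul, map_mul, mk_surfaceWordStd,
      hΨ, map_inv]
    group
  rcases htri with ⟨x, hx, h1⟩ | ⟨k, hk, x, R, hrot⟩ | hcr
  · -- (i) a symbol of trivial value: delete it
    exfalso
    set L := w.filter fun y => ¬ (y.1 = x.1) with hL
    have hLval : ψ (FreeGroup.mk L) = ψ (FreeGroup.mk w) := by
      rw [← hliftX]
      have := lift_killHom (fun i => i = x.1) X (fun i hi => by rw [hi]; exact h1) (FreeGroup.mk w)
      rwa [killHom_mk] at this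
    have hbal : IsBalanced L := isBalanced_filter_fst_ne hq.isBalanced x.1
    obtain ⟨y, hy, hyx⟩ := forall_exists_fst_eq_of_map_mk_eq_conj_surfaceWordStd L hbal ψ (Ψ c' * d)
      (by rw [hLval, hval, mk_surfaceWordStd]) x.1
    rw [hL, mem_filter] at hy
    simp only [decide_eq_true_eq] at hy
    exact hy.2 hyx
  · -- (ii) an inessential symbol: delete it
    exfalso
    have hqr : IsQuadratic (x :: (x.1, !x.2) :: R) := hrot ▸ hq.perm (rotate_perm w k).symm
    obtain ⟨hbal, havoid⟩ := isBalanced_of_isQuadratic_cons_cons hqr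
    have hRval : ψ (FreeGroup.mk R) =
        ((ψ (FreeGroup.mk (w.take k)))⁻¹ * (Ψ c' * d)) * surfaceRelator g *
          ((ψ (FreeGroup.mk (w.take k)))⁻¹ * (Ψ c' * d))⁻¹ := by
      have e1 : FreeGroup.mk R = FreeGroup.mk (w.rotate k) := by
        rw [hrot, mk_cons_cons_of_cancel (x := x) (y := (x.1, !x.2)) ⟨rfl, by simp⟩ R]
      rw [e1, mk_rotate_eq_conj w hk.le, map_mul, map_mul, map_inv, hval]
      group
    obtain ⟨y, hy, hyx⟩ := forall_exists_fst_eq_of_map_mk_eq_conj_surfaceWordStd R hbal ψ _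
      (by rw [hRval, mk_surfaceWordStd]) x.1
    exact havoid y hy hyx
  · -- (iii) cyclically reduced: every value is a single letter of the relator
    obtain ⟨t, ht⟩ := toWord_eq_singleton_of_cyclicallyReduced hg w hq hlen X (Ψ c' * d)
      (by rw [hliftX, hval]) hcr
    set N := 4 * g with hN
    have hsw : (surfaceWordStd g).length = N := length_surfaceWordStd g
    have hmemw : ∀ y : surfaceGen g × Bool, y ∈ w := fun y => hperm.mem_iff.2 (mem_surfaceWordStd y)
    have hnd : w.Nodup := hperm.nodup_iff.2 (nodup_surfaceWordStd g)
    -- the letter carried by a letter of `w`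
    have hidx : ∀ y : surfaceGen g × Bool, w.idxOf y < w.length := fun y => idxOf_lt_length_of_mem (hmemw y)
    set V : surfaceGen g × Bool → surfaceGen g × Bool := fun y =>
      (surfaceWordStd g)[(w.idxOf y + t) % N]'(by rw [hsw]; exact Nat.mod_lt _ (by omega)) with hV
    have hV1 : ∀ y, ψ (sgen y.1 y.2) = FreeGroup.mk [V y] := by
      intro y
      have h := ht (w.idxOf y) (hidx y)
      simp only [getElem_idxOf (hidx y)] at h
      rw [← hliftX, ← FreeGroup.mk_toWord (x := FreeGroup.lift X (sgen y.1 y.2)), h]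
    have hVinj : Function.Injective V := by
      intro y z hyz
      have h1 := (nodup_surfaceWordStd g).getElem_inj_iff.1 hyz
      have hy := hidx y
      have hz := hidx z
      rw [hlen] at hy hz
      have h2 : w.idxOf y = w.idxOf z := by
        have h3 : w.idxOf y % N = w.idxOf z % N := Nat.ModEq.add_right_cancel' t h1
        rwa [Nat.mod_eq_of_lt hy, Nat.mod_eq_of_lt hz] at h3
      rw [← getElem_idxOf (hidx y), ← getElem_idxOf (hidx z)]
      simp only [h2]
    have hV3 : ∀ y : surfaceGen g × Bool, V (y.1, !y.2) = ((V y).1, !(V y).2) := by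
      intro y
      have h := hV1 (y.1, !y.2)
      change ψ (sgen y.1 (!y.2)) = FreeGroup.mk [V (y.1, !y.2)] at h
      rw [sgen_not, map_inv, hV1 y, FreeGroup.inv_mk] at h
      have h' := congrArg FreeGroup.toWord h
      rw [FreeGroup.toWord_mk, FreeGroup.toWord_mk,
        show FreeGroup.invRev [V y] = [((V y).1, !(V y).2)] from rfl, FreeGroup.reduce_singleton,
        FreeGroup.reduce_singleton] at h'
      exact (List.singleton_inj.1 h').symm
    -- the signed relabelling of the generators
    set τ : surfaceGen g → surfaceGen g := fun i => (V (i, true)).1 with hτ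
    set sgn : surfaceGen g → Bool := fun i => (V (i, true)).2 with hsgn
    have hτinj : Function.Injective τ := by
      intro i j hij
      change (V (i, true)).1 = (V (j, true)).1 at hij
      by_cases hs : (V (i, true)).2 = (V (j, true)).2
      · have : V (i, true) = V (j, true) := Prod.ext hij hs
        exact congrArg Prod.fst (hVinj this)
      · exfalso
        have hb : ∀ a b : Bool, a ≠ b → b = !a := by decide
        have e : V (j, true) = ((V (i, true)).1, !(V (i, true)).2) := Prod.ext hij.symm (hb _ _ hs)
        rw [← hV3 (i, true)] at e
        have h2 := congrArg Prod.snd (hVinj e)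
        exact Bool.noConfusion h2
    have hτbij : Function.Bijective τ := ⟨hτinj, Finite.injective_iff_surjective.1 hτinj⟩
    set σ : surfaceGen g ≃ surfaceGen g := Equiv.ofBijective τ hτbij with hσ
    set ρ := signedRelabel σ sgn with hρ
    have hρψ : ∀ i, ρ (FreeGroup.of i) = ψ (FreeGroup.of i) := by
      intro i
      rw [hρ, signedRelabel_of, hσ, Equiv.ofBijective_apply, ← sgen_true, hV1 (i, true)]
      rfl
    have hψρ : ψ = ρ.toMonoidHom := FreeGroup.ext_hom _ _ fun i => (hρψ i).symm
    -- conclusion: `Ψ = ρ ∘ θ⁻¹`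
    have e3 : ⇑Ψ = ⇑ρ ∘ ⇑θ.symm := funext fun x => by
      have : Ψ x = ψ (θ.symm x) := by
        rw [hψ, MonoidHom.comp_apply, MulEquiv.coe_toMonoidHom, MulEquiv.apply_symm_apply]
      rw [this, hψρ]
      rfl
    rw [e3]
    exact ρ.bijective.comp θ.symm.bijective

end SurfaceGroup

end Literature.Topology.FourManifolds
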